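import Mathlib
import Literature.Probability.Percolation.MinOpenCut
import Summits.CriticalPhenomena.PercolationContinuityZ3.Theses.PercBudgetLadder
import Summits.CriticalPhenomena.PercolationContinuityZ3.Theorems.DefectDimension.Negative.AllOpenCutsets

/-!
# `DefectDimension` (crux `stmt-CriticalPhenomena-5250`), line `chemical-tortuosity-packing`:
# negative-side facts about its stub set (drefute seat)

Support file (all `sorry`-free, standard axioms) for the skeleton
`Cruxes/DefectDimension/Lines/chemical-tortuosity-packing.lean` (lead rev 2, sha `dd35c4e3c6fc`),
whose stubs are stated inline over tree declarations; `longCrossings n ℓ` below is that inline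
tortuosity event as a named set (membership is the stubs' hypothesis by `Iff.rfl`).

* LOAD-BEARING HYPOTHESES OF `stub_packing` (`MinCut(n,2n) ≤ 3(4n+1)³/ℓ` on `longCrossings n ℓ`
  for lattice `ω` and `ℓ > 0`) — each weakening is FALSE:
  - `stubPacking_false_without_pos`: drop `0 < ℓ` (witness `n = 1`, `ℓ = -1`, `ω = ∅`: negative budget);
  - `stubPacking_false_nonneg_ell`: weaken to `0 ≤ ℓ` (witness `ℓ = 0`, `ω = E(ℤ³)`: `x/0 = 0` makes
    the budget plain blocking, refuted by `Negative.edgeSet_notMem_budgetEvent`);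
  - `stubPacking_false_without_lattice`: drop `ω ⊆ E(ℤ³)` (triage r1 witness W1, kernel-checked:
    the junk configuration of all long-range pairs `{x, (2,a,b)}`, `x ∈ B(1)`, `|a|,|b| ≤ 2`, has
    every crossing walk of length `≥ 1 = ℓ` but every cutset contains the `27·25 = 675 > 375`
    junk pairs) — `openGraph = fromEdgeSet` is lattice-free, so the hypothesis is necessary.
* CRITICALITY IS LOAD-BEARING IN `stub_weakTortuosity`: `weakTortuosity_false_at_one` — the stub's
  statement with `criticalProbI 3` replaced by `1` is FALSE (`P_1 = δ_{E(ℤ³)}` and the straight ray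
  `(n,0,0) → (2n,0,0)` is an open crossing walk of length `n < n^{1+s}`, `exists_rayWalk`); with
  `Negative.Subcritical` (below `p_c` the annulus is blocked w.h.p., so the event holds vacuously)
  the stub, like the crux, is exactly critical.
-/

noncomputable section

open MeasureTheory Filter Topology
open Literature.Probability.Percolation Literature.Probability.LatticeModels

namespace Summit.CriticalPhenomena.PercolationContinuityZ3.Theorems.DefectDimension.Negative

/-- **Tortuosity event** `longCrossings n ℓ` (the planner's event, spelled inline in the lead's
rev-2 stubs; membership is definitionally the stubs' hypothesis, `mem_longCrossings_iff`): every
walk of the open graph induced on `B(2n)` from a vertex of `B(n)` to a vertex of `∂ⁱⁿB(2n)` has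
length `≥ ℓ`. [folklore] -/
def longCrossings (n : ℕ) (ℓ : ℝ) : Set (BondConfig (Site 3)) :=
  {ω | ∀ x y : ((box 3 (2 * n) : Finset (Site 3)) : Set (Site 3)),
    (x : Site 3) ∈ box 3 n → (y : Site 3) ∈ innerBoundary (zdGraph 3) (box 3 (2 * n)) →
    ∀ w : ((openGraph ω).induce ((box 3 (2 * n) : Finset (Site 3)) : Set (Site 3))).Walk x y,
      ℓ ≤ (w.length : ℝ)}

/-- Membership in `longCrossings` is the stubs' inline hypothesis, by `rfl`. [folklore] -/
theorem mem_longCrossings_iff {n : ℕ} {ℓ : ℝ} {ω : BondConfig (Site 3)} :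
    ω ∈ longCrossings n ℓ ↔ ∀ x y : ((box 3 (2 * n) : Finset (Site 3)) : Set (Site 3)),
      (x : Site 3) ∈ box 3 n → (y : Site 3) ∈ innerBoundary (zdGraph 3) (box 3 (2 * n)) →
      ∀ w : ((openGraph ω).induce ((box 3 (2 * n) : Finset (Site 3)) : Set (Site 3))).Walk x y,
        ℓ ≤ (w.length : ℝ) := Iff.rfl

/-! ## Elementary structure of the tortuosity event (for the prover and for the costume check) -/

/-- `longCrossings n ℓ` is a DECREASING event: closing edges removes walks. [folklore] -/
theorem longCrossings_anti {n : ℕ} {ℓ : ℝ} {ω ω' : BondConfig (Site 3)} (h : ω ⊆ ω')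
    (hω' : ω' ∈ longCrossings n ℓ) : ω ∈ longCrossings n ℓ := by
  intro x y hx hy w
  have hle : (openGraph ω).induce ((box 3 (2 * n) : Finset (Site 3)) : Set (Site 3)) ≤
      (openGraph ω').induce ((box 3 (2 * n) : Finset (Site 3)) : Set (Site 3)) := by
    intro u v huv
    rw [SimpleGraph.induce_adj, openGraph_adj] at huv ⊢
    exact ⟨h huv.1, huv.2⟩
  have hlen : (w.mapLe hle).length = w.length := by
    have h1 := (w.mapLe hle).length_support
    have h2 := w.length_support
    rw [SimpleGraph.Walk.support_mapLe_eq_support] at h1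
    omega
  have := hω' x y hx hy (w.mapLe hle)
  rwa [hlen] at this

/-- `longCrossings n ℓ` is monotone (decreasing) in the level `ℓ`. [folklore] -/
theorem longCrossings_mono_level {n : ℕ} {ℓ ℓ' : ℝ} (h : ℓ ≤ ℓ') :
    longCrossings n ℓ' ⊆ longCrossings n ℓ :=
  fun _ hω x y hx hy w => h.trans (hω x y hx hy w)

/-- **Blocked configurations are tortuous at every level** (the costume relation, kernel-checked):
`budgetEvent n b ⊆ longCrossings n ℓ` for budgets `b < 1` — a blocked annulus has no crossing walk
at all. Hence any RSW-type input "`P_{p_c}(A(n,2n) blocked) ≥ δ` at all large scales" gives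
`stub_weakTortuosity` vacuously (and the crux directly); the stub is implied by such crossing
bounds and — by the `d > 6` calibration (`d_min = 2` there while they fail) — presumably does not
imply them. [folklore] -/
theorem budgetEvent_subset_longCrossings {n : ℕ} {b : ℝ} (hb : b < 1) (ℓ : ℝ) :
    budgetEvent n b ⊆ longCrossings n ℓ := by
  rintro ω ⟨S, hS, hcut⟩ x y hx hy w
  exfalso
  have hS0 : S = ∅ := by
    have h1 : (S.card : ℝ) < 1 := hS.trans_lt hb
    have h2 : S.card < 1 := by exact_mod_cast h1
    exact Finset.card_eq_zero.1 (by omega)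
  subst hS0
  apply hcut
  refine ⟨x, hx, y, hy, ?_⟩
  rw [Finset.coe_empty, Set.sdiff_empty]
  exact ⟨x.2, y.2, w.reachable⟩

/-! ## `0 < ℓ` is load-bearing in `stub_packing` -/

/-- **`stub_packing` is FALSE with `0 < ℓ` dropped**: at `ℓ = -1` the tortuosity hypothesis is
trivially true while the budget `3·5³/(-1) < 0` admits no finite set (witness `n = 1`, `ω = ∅`). [folklore] -/
theorem stubPacking_false_without_pos :
    ¬ ∀ (n : ℕ) (ℓ : ℝ) (ω : BondConfig (Site 3)), ω ⊆ (zdGraph 3).edgeSet →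
      ω ∈ longCrossings n ℓ → ω ∈ budgetEvent n (3 * (4 * (n : ℝ) + 1) ^ 3 / ℓ) := by
  intro h
  have hyp : (∅ : BondConfig (Site 3)) ∈ longCrossings 1 (-1) := by
    intro x y _ _ w
    have : (0 : ℝ) ≤ (w.length : ℝ) := Nat.cast_nonneg _
    linarith
  obtain ⟨S, hS, -⟩ := h 1 (-1) ∅ (Set.empty_subset _) hyp
  have h0 : (0 : ℝ) ≤ S.card := Nat.cast_nonneg _
  norm_num at hS
  linarith

/-- **Even `0 ≤ ℓ` does not suffice in `stub_packing`**: at `ℓ = 0` Lean's `x / 0 = 0` makes the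
budget `0`, i.e. plain blocking, and the all-open configuration `E(ℤ³)` (a lattice configuration
satisfying the tortuosity hypothesis trivially) is not blocked (`edgeSet_notMem_budgetEvent`,
witness `n = 1`). [folklore] -/
theorem stubPacking_false_nonneg_ell :
    ¬ ∀ (n : ℕ) (ℓ : ℝ) (ω : BondConfig (Site 3)), ω ⊆ (zdGraph 3).edgeSet → 0 ≤ ℓ →
      ω ∈ longCrossings n ℓ → ω ∈ budgetEvent n (3 * (4 * (n : ℝ) + 1) ^ 3 / ℓ) := by
  intro h
  have hyp : (zdGraph 3).edgeSet ∈ longCrossings 1 0 := by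
    intro x y _ _ w
    exact Nat.cast_nonneg _
  have hmem := h 1 0 (zdGraph 3).edgeSet subset_rfl le_rfl hyp
  rw [div_zero] at hmem
  have hmono : budgetEvent 1 0 ⊆ budgetEvent 1 (((1 : ℕ) : ℝ) ^ (2 - (1 : ℝ))) :=
    budgetEvent_mono_budget (by norm_num)
  exact edgeSet_notMem_budgetEvent (n := 1) le_rfl zero_le_one (hmono hmem)


/-! ## The lattice hypothesis `ω ⊆ E(ℤ³)` is load-bearing (triage r1 witness W1, now kernel-checked) -/

/-- Junk targets: the face points `(2, a, b)` of `∂ⁱⁿB(2)`. [folklore] -/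
def junkTarget (ab : ℤ × ℤ) : Site 3 := ![2, ab.1, ab.2]

/-- Coordinate `0` of a junk target is `2`. [folklore] -/
@[simp] theorem junkTarget_apply_zero (ab : ℤ × ℤ) : junkTarget ab 0 = 2 := rfl
/-- Coordinate `1` of a junk target. [folklore] -/
@[simp] theorem junkTarget_apply_one (ab : ℤ × ℤ) : junkTarget ab 1 = ab.1 := rfl
/-- Coordinate `2` of a junk target. [folklore] -/
@[simp] theorem junkTarget_apply_two (ab : ℤ × ℤ) : junkTarget ab 2 = ab.2 := rfl

/-- The index set of junk targets, `|a|, |b| ≤ 2` (25 of the 98 points of `∂ⁱⁿB(2)`). [folklore] -/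
def junkIdx : Finset (ℤ × ℤ) := Finset.Icc (-2 : ℤ) 2 ×ˢ Finset.Icc (-2 : ℤ) 2

/-- The junk (non-lattice) configuration: every long-range pair `{x, (2,a,b)}`, `x ∈ B(1)`, is
"open". Each such pair is a one-edge open crossing of `A(1,2)` inside `B(2)`. [folklore] -/
def junkConfig : BondConfig (Site 3) :=
  {e | ∃ x ∈ box 3 1, ∃ ab ∈ junkIdx, e = s(x, junkTarget ab)}

/-- Junk targets lie in `B(2)`. [folklore] -/
theorem junkTarget_mem_box {ab : ℤ × ℤ} (hab : ab ∈ junkIdx) : junkTarget ab ∈ box 3 (2 * 1) := by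
  simp only [junkIdx, Finset.mem_product, Finset.mem_Icc] at hab
  rw [mem_box]
  intro i
  fin_cases i
  · simp
  · simp; constructor <;> omega
  · simp; constructor <;> omega

/-- Junk targets lie on `∂ⁱⁿB(2)` (coordinate `0` equals `2`). [folklore] -/
theorem junkTarget_mem_innerBoundary {ab : ℤ × ℤ} (hab : ab ∈ junkIdx) :
    junkTarget ab ∈ innerBoundary (zdGraph 3) (box 3 (2 * 1)) :=
  DCT16.mem_innerBoundary_box_of_natAbs_eq (junkTarget_mem_box hab) (i := 0) (by simp)

/-- Junk targets are outside `B(1)`. [folklore] -/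
theorem junkTarget_notMem_box_one (ab : ℤ × ℤ) : junkTarget ab ∉ box 3 1 := by
  rw [mem_box, not_forall]
  exact ⟨0, by simp⟩

/-- Every cutset of the junk configuration contains every junk pair. [folklore] -/
theorem junk_mem_of_isCutset {S : Finset (Sym2 (Site 3))}
    (hS : ¬ ∃ x ∈ box 3 1, ∃ y ∈ innerBoundary (zdGraph 3) (box 3 (2 * 1)),
      (junkConfig \ ↑S) ∈ openConnIn (↑(box 3 (2 * 1)) : Set (Site 3)) x y)
    {x : Site 3} (hx : x ∈ box 3 1) {ab : ℤ × ℤ} (hab : ab ∈ junkIdx) :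
    s(x, junkTarget ab) ∈ S := by
  by_contra hnot
  apply hS
  have hx2 : x ∈ (↑(box 3 (2 * 1)) : Set (Site 3)) :=
    Finset.mem_coe.2 (box_mono 3 (by norm_num : 1 ≤ 2 * 1) hx)
  have hy2 : junkTarget ab ∈ (↑(box 3 (2 * 1)) : Set (Site 3)) :=
    Finset.mem_coe.2 (junkTarget_mem_box hab)
  have hne : x ≠ junkTarget ab := fun h => junkTarget_notMem_box_one ab (h ▸ hx)
  refine ⟨x, hx, junkTarget ab, junkTarget_mem_innerBoundary hab, hx2, hy2, ?_⟩
  refine SimpleGraph.Adj.reachable (SimpleGraph.induce_adj.2 ((openGraph_adj _ _ _).2 ⟨?_, hne⟩))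
  exact ⟨⟨x, hx, ab, hab, rfl⟩, fun h => hnot (Finset.mem_coe.1 h)⟩

/-- **W1, kernel-checked: `stub_packing` is FALSE without `ω ⊆ E(ℤ³)`.** For the junk
configuration every crossing walk has length `≥ 1 = ℓ`, but every cutset contains the
`27 · 25 = 675 > 375 = 3·5³/1` junk pairs `{x, (2,a,b)}`. [folklore] -/
theorem stubPacking_false_without_lattice :
    ¬ ∀ (n : ℕ) (ℓ : ℝ) (ω : BondConfig (Site 3)), 0 < ℓ →
      ω ∈ longCrossings n ℓ → ω ∈ budgetEvent n (3 * (4 * (n : ℝ) + 1) ^ 3 / ℓ) := by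
  classical
  intro h
  have hyp : junkConfig ∈ longCrossings 1 1 := by
    intro x y hx hy w
    have hne : x ≠ y := by
      intro hxy
      have hy1 : (y : Site 3) ∉ box 3 1 := notMem_box_of_mem_innerBoundary le_rfl hy
      exact hy1 (hxy ▸ hx)
    have hlen : w.length ≠ 0 := fun h0 => hne (SimpleGraph.Walk.eq_of_length_eq_zero h0)
    have : (1 : ℝ) ≤ (w.length : ℝ) := by exact_mod_cast Nat.one_le_iff_ne_zero.2 hlen
    exact this
  obtain ⟨S, hS, hcut⟩ := h 1 1 junkConfig one_pos hyp
  have hbudget : S.card ≤ 375 := by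
    have h' : (S.card : ℝ) ≤ 375 := by
      have h375 : (3 * (4 * ((1 : ℕ) : ℝ) + 1) ^ 3 / 1 : ℝ) = 375 := by norm_num
      rw [h375] at hS
      exact hS
    exact_mod_cast h'
  -- the injection (x, ab) ↦ s(x, junkTarget ab) from box 3 1 ×ˢ junkIdx into S
  set I : Finset (Site 3 × (ℤ × ℤ)) := box 3 1 ×ˢ junkIdx with hI
  have hmaps : Set.MapsTo (fun q : Site 3 × (ℤ × ℤ) => s(q.1, junkTarget q.2)) ↑I ↑S := by
    rintro ⟨x, ab⟩ hq
    simp only [hI, Finset.coe_product, Set.mem_prod, Finset.mem_coe] at hq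
    exact Finset.mem_coe.2 (junk_mem_of_isCutset hcut hq.1 hq.2)
  have hinj : Set.InjOn (fun q : Site 3 × (ℤ × ℤ) => s(q.1, junkTarget q.2)) ↑I := by
    rintro ⟨x, ab⟩ hq ⟨x', ab'⟩ hq' hxx
    simp only [hI, Finset.coe_product, Set.mem_prod, Finset.mem_coe] at hq hq'
    simp only at hxx
    rw [Sym2.eq_iff] at hxx
    rcases hxx with ⟨h1, h2⟩ | ⟨h1, -⟩
    · have e1 := congrFun h2 1
      have e2 := congrFun h2 2
      simp at e1 e2
      subst h1
      simp only [Prod.mk.injEq, true_and]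
      exact Prod.ext e1 e2
    · exact absurd (h1 ▸ hq.1) (junkTarget_notMem_box_one ab')
  have hcardI : I.card = 675 := by
    rw [hI, Finset.card_product, card_box, junkIdx, Finset.card_product, Int.card_Icc]
    rfl
  have hle : I.card ≤ S.card := Finset.card_le_card_of_injOn _ hmaps hinj
  rw [hcardI] at hle
  omega

/-! ## Criticality is load-bearing in `stub_weakTortuosity`: the tortuosity event fails at `p = 1` -/

/-- The straight ray `(n,0,0) → (n+t,0,0)` is an open walk of length `t` of the all-open
configuration inside `B(2n)` (`t ≤ n`). [folklore] -/
theorem exists_rayWalk (n t : ℕ) (ht : t ≤ n) :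
    ∃ (h0 : rayVert n 0 0 0 ∈ ((box 3 (2 * n) : Finset (Site 3)) : Set (Site 3)))
      (h1 : rayVert n 0 0 t ∈ ((box 3 (2 * n) : Finset (Site 3)) : Set (Site 3)))
      (w : ((openGraph (zdGraph 3).edgeSet).induce
        ((box 3 (2 * n) : Finset (Site 3)) : Set (Site 3))).Walk ⟨_, h0⟩ ⟨_, h1⟩),
      w.length = t := by
  have ha : |(0 : ℤ)| ≤ n := by simp
  induction t with
  | zero =>
    exact ⟨Finset.mem_coe.2 (rayVert_mem_box ha ha (Nat.zero_le _)),
      Finset.mem_coe.2 (rayVert_mem_box ha ha (Nat.zero_le _)), SimpleGraph.Walk.nil, rfl⟩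
  | succ t ih =>
    obtain ⟨h0, h1, w, hw⟩ := ih (by omega)
    have h2 : rayVert n 0 0 (t + 1) ∈ ((box 3 (2 * n) : Finset (Site 3)) : Set (Site 3)) :=
      Finset.mem_coe.2 (rayVert_mem_box ha ha ht)
    refine ⟨h0, h2, w.concat ?_, by rw [SimpleGraph.Walk.length_concat, hw]⟩
    exact SimpleGraph.induce_adj.2 ((openGraph_adj _ _ _).2
      ⟨(SimpleGraph.mem_edgeSet _).2 (rayVert_adj n 0 0 t), (rayVert_adj n 0 0 t).ne⟩)

/-- Under the all-open configuration the tortuosity event at level `n^{1+s}` FAILS for `n ≥ 2`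
(the straight ray is a crossing of length `n < n^{1+s}`). [folklore] -/
theorem edgeSet_notMem_longCrossings {n : ℕ} (hn : 2 ≤ n) {s : ℝ} (hs : 0 < s) :
    (zdGraph 3).edgeSet ∉ longCrossings n ((n : ℝ) ^ (1 + s)) := by
  intro h
  have ha : |(0 : ℤ)| ≤ n := by simp
  obtain ⟨h0, h1, w, hw⟩ := exists_rayWalk n n le_rfl
  have hlen := h ⟨_, h0⟩ ⟨_, h1⟩ (rayVert_zero_mem_box ha ha) (rayVert_last_mem_innerBoundary ha ha) w
  rw [hw] at hlen
  have hlt : (n : ℝ) < (n : ℝ) ^ (1 + s) := by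
    have h1n : (1 : ℝ) < n := by exact_mod_cast hn
    calc (n : ℝ) = (n : ℝ) ^ (1 : ℝ) := (Real.rpow_one _).symm
      _ < (n : ℝ) ^ (1 + s) := Real.rpow_lt_rpow_of_exponent_lt h1n (by linarith)
  linarith

/-- **`stub_weakTortuosity` with `p_c` replaced by `p = 1` is FALSE** (`P_1 = δ_{E(ℤ³)}` and the
straight ray): any proof of the stub must use that the parameter is `< 1` (indeed critical:
below `p_c` the event holds vacuously w.h.p., cf. `Negative.Subcritical`). [folklore] -/
theorem weakTortuosity_false_at_one :
    ¬ ∃ s δ : ℝ, 0 < s ∧ 0 < δ ∧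
      ∀ᶠ n : ℕ in atTop, δ ≤ (bondPercolation (zdGraph 3) 1).real
        {ω | ∀ x y : ((box 3 (2 * n) : Finset (Site 3)) : Set (Site 3)),
          (x : Site 3) ∈ box 3 n → (y : Site 3) ∈ innerBoundary (zdGraph 3) (box 3 (2 * n)) →
          ∀ w : ((openGraph ω).induce ((box 3 (2 * n) : Finset (Site 3)) : Set (Site 3))).Walk x y,
            (n : ℝ) ^ (1 + s) ≤ (w.length : ℝ)} := by
  rintro ⟨s, δ, hs, hδ, hev⟩
  obtain ⟨n, hn, hn2⟩ := (hev.and (eventually_ge_atTop 2)).exists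
  have h0 : (bondPercolation (zdGraph 3) 1).real (longCrossings n ((n : ℝ) ^ (1 + s))) = 0 := by
    rw [bondPercolation_one_eq_dirac, measureReal_def, Measure.dirac_apply,
      Set.indicator_of_notMem (edgeSet_notMem_longCrossings hn2 hs)]
    simp
  change δ ≤ (bondPercolation (zdGraph 3) 1).real (longCrossings n ((n : ℝ) ^ (1 + s))) at hn
  linarith

end Summit.CriticalPhenomena.PercolationContinuityZ3.Theorems.DefectDimension.Negative

end
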